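import Mathlib
import HarnessLib
import Summits.Ventures.LatticeQCDFlow.Scoring.RegenerativeMedianOfGroups
import Summits.Ventures.LatticeQCDFlow.Exactness.ApproxTrivializingSampler

/-!
# Any independence Metropolis sampler with a log-density-ratio oscillation bound `M` carries
# regeneration tours at rate `e^{−M}`: its regenerative estimator has the CLT-free error bar
# `4((2 − e^{−M})(2C)²/s² + 1 − e^{−M})/R`, and the median of tour-group estimates is exponentially sure

HONEST FRAMING: exact (Metropolis-corrected) sampling algorithms for lattice gauge theory;
figures of merit are autocorrelation/cost numbers at stated couplings and volumes; no
continuum-physics claim.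

Venture `LatticeQCDFlow` (cell pub-lqcd), topic `Scoring`; FANOUT row 8 (`s0-cpn-nemc`, GEN-16).
NEW WORK of the cell, not a published result; no definition is introduced.  The general-state-space
instance of the regeneration-tour chapter (`Scoring/RegenerativeEstimatorSharp.lean`,
`Scoring/RegenerativeMedianOfGroups.lean`), composed with the tree's
`Exactness.indepMH_exact_doeblin_of_density_ratio` (row 30 / lean-2): for probability laws
`q = ρ · π` with `ρ > 0` measurable and `ρ x ≤ e^{M} ρ y` for all `x, y`, the independence Metropolis
kernel `K = indepMH q (1/ρ)` is EXACT for `π` and obeys Doeblin `K(x, ·) ≥ e^{−M} π`; hence every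
split kernel `κ̂` of `(K, π, e^{−M})` (one exists, `Scoring/SplitChain.exists_splitKernel`; its state
path IS the `K`-chain, `splitChain_map_fst`) carries regeneration tours to which the certificates
apply, from ANY initial law.  Printed counterpart NAMED ONLY: regenerative simulation for
independence chains (Mykland–Tierney–Yu 1995, JASA 90, §4.1 — the coins are realised
retrospectively: after an accepted move `x → y` flip heads with probability
`max(w(x), w(y)) / sup w`, `w = 1/ρ` the importance weight, no normalising constant needed) —
nothing is cited as a fact.

## Content (`π`, `q = ρ·π`, `M > 0` as above; `K = indepMH q (1/ρ)`; `κ̂` a split kernel of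
## `(K, π, e^{−M})`; `|f| ≤ C` measurable; tours, `Y_i`, `N_i`, groups as in the parent files)

* **`indepMH_regenerative_confidence`** — for `R ≥ 1` tours and `s > 0`, from any initial law:
  `P(s ≤ |Σ_{i=1}^R Y_i / Σ_{i=1}^R N_i − π(f)|) ≤ 4((2 − e^{−M})(2C)²/s² + (1 − e^{−M}))/R`;
* **`indepMH_regenerative_medianOfGroups`** — for `m ≥ 1` with
  `4((2 − e^{−M})(2C)²/s² + (1 − e^{−M}))/m ≤ 1/4` and every `K`:
  `P(K/2 ≤ #{bad groups among the first K}) ≤ e^{−K/8}`.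

Reading (value-free): a certified log-weight oscillation `M` of an independence proposal prices a
complete regenerative error-bar protocol with no block length, gap, variance or autocorrelation
input.  NOT CLAIMED: any `M` for a concrete proposal; optimal constants; unbounded observables; the
measurability / implementation of the retrospective coin (a statement about laws only).
-/

noncomputable section

namespace Summit.Ventures.LatticeQCDFlow.Scoring

open MeasureTheory ProbabilityTheory Filter Finset Summit.Ventures.LatticeQCDFlow.Exactness
open Literature.Probability.MarkovChains
open scoped ENNReal

variable {Ω : Type*} [MeasurableSpace Ω]

/-- **The regenerative estimator of an independence Metropolis run with log-density-ratio
oscillation `≤ M`: CLT-free error bar at regeneration rate `e^{−M}`, any start.** -/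
theorem indepMH_regenerative_confidence {π q : Measure Ω} [IsProbabilityMeasure π]
    [IsProbabilityMeasure q] {ρ : Ω → ℝ} (hρm : Measurable ρ) (hρ0 : ∀ x, 0 < ρ x)
    (hq : q = π.withDensity fun x => ENNReal.ofReal (ρ x)) {M : ℝ} (hM0 : 0 < M)
    (hM : ∀ x y, ρ x ≤ Real.exp M * ρ y)
    (κs : Kernel (Ω × Bool) (Ω × Bool)) [IsMarkovKernel κs]
    (hκs : haveI : Fact (Measurable fun x => (ρ x)⁻¹) := ⟨hρm.inv⟩
      ∀ p, κs p = (ENNReal.ofReal (Real.exp (-M)) • π).map (fun y : Ω => (y, true))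
        + ((1 - ENNReal.ofReal (Real.exp (-M))) • Doeblin.residualKernel
            (indepMH q fun x => (ρ x)⁻¹) π (ENNReal.ofReal (Real.exp (-M)))
            (fun x _ hB => (indepMH_exact_doeblin_of_density_ratio hρm hρ0 hq hM).2.2 x hB) p.1).map
          (fun y : Ω => (y, false)))
    (μs : Measure (Ω × Bool)) [IsProbabilityMeasure μs]
    {f : Ω → ℝ} (hf : Measurable f) {C : ℝ} (hC : ∀ x, |f x| ≤ C) {R : ℕ} (hR : 0 < R)
    {s : ℝ} (hs : 0 < s) :
    (Kernel.trajMeasure (X := fun _ : ℕ => Ω × Bool) μs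
        (fun n : ℕ => κs.comap (fun h : (i : ↥(Finset.Iic n)) → Ω × Bool =>
          h ⟨n, Finset.mem_Iic.2 le_rfl⟩) (measurable_pi_apply _))).real
      {x | s ≤ |(∑ i ∈ Finset.range R, ∑' u, (if (∑ s ∈ Finset.range u,
            (if (x (s + 1)).2 then (1 : ℕ) else 0)) = i + 1 then (1 : ℝ) else 0) * f (x u).1)
          / (∑ i ∈ Finset.range R, ∑' u, (if (∑ s ∈ Finset.range u,
            (if (x (s + 1)).2 then (1 : ℕ) else 0)) = i + 1 then (1 : ℝ) else 0))
          - ∫ z, f z ∂π|}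
      ≤ 4 * ((2 - Real.exp (-M)) * (2 * C) ^ 2 / s ^ 2 + (1 - Real.exp (-M))) / R := by
  haveI : Fact (Measurable fun x => (ρ x)⁻¹) := ⟨hρm.inv⟩
  obtain ⟨hinv, -, hdoeb⟩ := indepMH_exact_doeblin_of_density_ratio hρm hρ0 hq hM
  have hε0 : 0 < ENNReal.ofReal (Real.exp (-M)) := ENNReal.ofReal_pos.2 (Real.exp_pos _)
  have hε1 : ENNReal.ofReal (Real.exp (-M)) < 1 := by
    rw [ENNReal.ofReal_lt_one]
    exact Real.exp_lt_one_iff.2 (by linarith)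
  have hr : (ENNReal.ofReal (Real.exp (-M))).toReal = Real.exp (-M) :=
    ENNReal.toReal_ofReal (Real.exp_pos _).le
  have h := regenerative_estimator_confidence_sharp κs μs (κ := indepMH q fun x => (ρ x)⁻¹)
    (ν := π) (hmin := fun x _ hB => hdoeb x hB) hinv hε0 hε1 hκs hf hC hR hs
  rw [hr] at h
  exact h

/-- **Median of tour-group estimates for an independence Metropolis run: exponential, CLT-free
confidence at regeneration rate `e^{−M}`, any start.** -/
theorem indepMH_regenerative_medianOfGroups {π q : Measure Ω} [IsProbabilityMeasure π]
    [IsProbabilityMeasure q] {ρ : Ω → ℝ} (hρm : Measurable ρ) (hρ0 : ∀ x, 0 < ρ x)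
    (hq : q = π.withDensity fun x => ENNReal.ofReal (ρ x)) {M : ℝ} (hM0 : 0 < M)
    (hM : ∀ x y, ρ x ≤ Real.exp M * ρ y)
    (κs : Kernel (Ω × Bool) (Ω × Bool)) [IsMarkovKernel κs]
    (hκs : haveI : Fact (Measurable fun x => (ρ x)⁻¹) := ⟨hρm.inv⟩
      ∀ p, κs p = (ENNReal.ofReal (Real.exp (-M)) • π).map (fun y : Ω => (y, true))
        + ((1 - ENNReal.ofReal (Real.exp (-M))) • Doeblin.residualKernel
            (indepMH q fun x => (ρ x)⁻¹) π (ENNReal.ofReal (Real.exp (-M)))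
            (fun x _ hB => (indepMH_exact_doeblin_of_density_ratio hρm hρ0 hq hM).2.2 x hB) p.1).map
          (fun y : Ω => (y, false)))
    (μs : Measure (Ω × Bool)) [IsProbabilityMeasure μs]
    {f : Ω → ℝ} (hf : Measurable f) {C : ℝ} (hC : ∀ x, |f x| ≤ C) {m : ℕ} (hm : 0 < m)
    {s : ℝ} (hs : 0 < s)
    (hsmall : 4 * ((2 - Real.exp (-M)) * (2 * C) ^ 2 / s ^ 2 + (1 - Real.exp (-M))) / m ≤ 1 / 4)
    (K : ℕ) :
    (Kernel.trajMeasure (X := fun _ : ℕ => Ω × Bool) μs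
        (fun n : ℕ => κs.comap (fun h : (i : ↥(Finset.Iic n)) → Ω × Bool =>
          h ⟨n, Finset.mem_Iic.2 le_rfl⟩) (measurable_pi_apply _))).real
      {x | (K : ℝ) / 2 ≤ ∑ k ∈ Finset.range K,
        (if s ≤ |(∑ i ∈ Finset.range m, ∑' u, (if (∑ s ∈ Finset.range u,
              (if (x (s + 1)).2 then (1 : ℕ) else 0)) = k * (m + 1) + i + 1 then (1 : ℝ) else 0)
              * f (x u).1)
            / (∑ i ∈ Finset.range m, ∑' u, (if (∑ s ∈ Finset.range u,
              (if (x (s + 1)).2 then (1 : ℕ) else 0)) = k * (m + 1) + i + 1 then (1 : ℝ) else 0))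
            - ∫ z, f z ∂π| then (1 : ℝ) else 0)}
      ≤ Real.exp (-((K : ℝ) / 8)) := by
  haveI : Fact (Measurable fun x => (ρ x)⁻¹) := ⟨hρm.inv⟩
  obtain ⟨hinv, -, hdoeb⟩ := indepMH_exact_doeblin_of_density_ratio hρm hρ0 hq hM
  have hε0 : 0 < ENNReal.ofReal (Real.exp (-M)) := ENNReal.ofReal_pos.2 (Real.exp_pos _)
  have hε1 : ENNReal.ofReal (Real.exp (-M)) < 1 := by
    rw [ENNReal.ofReal_lt_one]
    exact Real.exp_lt_one_iff.2 (by linarith)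
  have hr : (ENNReal.ofReal (Real.exp (-M))).toReal = Real.exp (-M) :=
    ENNReal.toReal_ofReal (Real.exp_pos _).le
  have h := regenerative_medianOfGroups_confidence κs μs (κ := indepMH q fun x => (ρ x)⁻¹)
    (ν := π) (hmin := fun x _ hB => hdoeb x hB) hinv hε0 hε1 hκs hf hC hm hs
    (by rw [hr]; exact hsmall) K
  exact h

end Summit.Ventures.LatticeQCDFlow.Scoring

end
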